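import Summits.ResolutionOfSingularities.ResolutionOfSingularities.Theorems.FrobeniusClosingSteerRadicandSingularCriterion
import Literature.AlgebraicGeometry.Resolution.RegularLocalRingsNormal
import Literature.AlgebraicGeometry.Resolution.SymbolicPowersRegularQuotient
import HarnessLib

/-!
# Crux `Steer` (stmt-ResolutionOfSingularities-16345), chain W4.1, `p = 2` σ-line: AUTO-EQUIMULTIPLICITY AT `p = 2`
# (helper β, Theses-free, def-free)

OURS (campaign `res-hironaka`, rung L ★L-G4, slot W4.1; a statement about the route's own objects; it replaces the
role of no printed item and is NOT a statement of the manuscript under review [claim: Hironaka2017, status: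
under-review]; AI review is weaker than expert review). ORDER β of res-L0-w41-plan-1 (HOME/STATUS
2026-08-27T06:08:01Z); seat res-type-082.

## The statement

Let `(S, 𝔪)` be a REGULAR LOCAL ring of prime characteristic `p`, `f ∈ S`, and `P ⊂ S` a prime ideal such that
`S/P` is again regular. Read the `p`-radicand torsor `T^p = f` over the local ring `S_P` of the base at `P`
(`AdjoinRoot (X ^ p - C (algebraMap S S_P f))` = the W4.1 sketches' `RadicandRing S_P p f`; «singular at `P`» =
`IsSingPrime S p f P` of res-L0-w41-lead-1's `Steer_r21.lean` §σ2, UNFOLDED). Then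

  **`T^p = f` is singular at `P`  ⟺  `f − g^p ∈ P²` for some `g ∈ S`**
  (`not_isRegularLocalRing_atPrime_iff_exists_sub_pow_mem_sq`).

In particular at `p = 2`, where `P² = P^p`, singularity at a top singular component `P ≠ 𝔪` with `S/P` regular
FORCES the equimultiplicity clause `∃ g, f − g^2 ∈ P^2` of `IsPermissibleCentre S 2 f P`: that clause is REDUNDANT,
and a σ_top-permissible centre at `p = 2` is just «a top singular component `≠ 𝔪` with regular quotient»
(`isPermissibleCentre_two_iff`, the corollary in the consumer's form, the §σ2 bodies unfolded as binders).

## Proof (all bricks in the tree)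

`⇒`: `S_P` is regular (`isRegularLocalRing_localization_atPrime`, Serre) of characteristic `p`, so by the
singularity criterion for `p`-radicand germs (`RadicandSingular.not_isRegularLocalRing_adjoinRoot_atPrime_iff`,
res-type-082 p503226) there is `γ ∈ S_P` with `f − γ^p ∈ 𝔪_{S_P}²`. Write `γ = a/s`, `s ∉ P`; then
`s^p f − a^p ∈ P`, i.e. `ā^p = f̄·s̄^p` in the domain `S/P`, so `s̄^p ∣ ā^p`; `S/P` is regular, hence NORMAL
(`isIntegrallyClosed_of_isRegularLocalRing`, Matsumura 19.4), so `s̄ ∣ ā` (`IsIntegrallyClosed.pow_dvd_pow_iff`):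
`a − s g₀ ∈ P` for some `g₀ ∈ S`, i.e. `γ − g₀ ∈ P S_P = 𝔪_{S_P}` (`exists_sub_algebraMap_mem_maximalIdeal`). In
characteristic `p`, **`f − g₀^p = (f − γ^p) + (γ − g₀)^p ∈ 𝔪_{S_P}² + 𝔪_{S_P}^p ⊆ 𝔪_{S_P}² = P² S_P`**, and
`P² S_P ∩ S = P⁽²⁾ = P²` because `S/P` is regular (`comap_map_pow_eq_pow_of_isRegularLocalRing_quotient`,
Matsumura 16.2 (ii)). `⇐`: `f − g^p ∈ P² ⇒ f − g^p ∈ (P S_P)² = 𝔪_{S_P}²`, and the criterion.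

## What is proved (namespace `…Theorems.SwitchingDichotomy.AutoPermissible`)
* `charP_localization_atPrime`, `exists_sub_algebraMap_mem_maximalIdeal` (the normality step),
  `exists_sub_pow_mem_sq_of_not_isRegularLocalRing_atPrime` (⇒, any prime `p`),
  `not_isRegularLocalRing_atPrime_of_sub_pow_mem_sq` (⇐, any `p`, no hypothesis on `S/P`),
  `not_isRegularLocalRing_atPrime_iff_exists_sub_pow_mem_sq` (⟺).
* `exists_sub_sq_mem_sq_of_singular_atPrime` — the ORDER's `K`-form verbatim (`K` a field of characteristic `2`,
  `R : Subring K` regular local).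
* `permissible_iff_of_singular` (parametric) and `isPermissibleCentre_two_iff` (literal: the bodies of
  `IsPermissibleCentre` / `IsTopSingComponent` / `IsSingPrime` / `RadicandRing` of `Steer_r21.lean` accb5a324610e606
  §σ2 unfolded as printed there, `p := 2`); `not_exists_permissible_two_iff` — «no permissible centre» ⟺ «every top
  singular component `≠ 𝔪` has SINGULAR quotient `S/P`»; `sigmaTopCentre_maximalIdeal_two_iff` — the body of
  `IsSigmaTopCentre R 2 f 𝔪` (the POINT STEP) ⟺ that ∧ the multiplicity clause at `𝔪` (the reading of PT₁ at `p = 2`).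

No Theses file is imported; nothing here is a route item or a registration.
[cite: Matsumura1987, Thm. 14.2, Thm. 16.2, Thm. 19.4]
-/

noncomputable section

-- `Summit.<S>.<S>.…` duplicates the summit name by design (single-problem summit).
set_option linter.dupNamespace false

open Polynomial IsLocalRing

namespace Summit.ResolutionOfSingularities.ResolutionOfSingularities.Theorems.SwitchingDichotomy.AutoPermissible

open Literature.AlgebraicGeometry.Resolution

universe u

/-! ## §1 Over an abstract regular local ring of characteristic `p` -/

section Regular

variable {S : Type u} [CommRing S] [IsRegularLocalRing S] (p : ℕ) [Fact p.Prime] [CharP S p]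

omit [Fact p.Prime] in
/-- The localisation of a regular local ring of characteristic `p` at a prime ideal has characteristic `p` (the
localisation map of a domain is injective). [folklore] -/
theorem charP_localization_atPrime (P : Ideal S) [P.IsPrime] : CharP (Localization.AtPrime P) p := by
  haveI : IsDomain S := isDomain_of_isRegularLocalRing S
  exact charP_of_injective_algebraMap
    (IsLocalization.injective (Localization.AtPrime P) (Ideal.primeCompl_le_nonZeroDivisors P)) p

omit [IsRegularLocalRing S] [CharP S p] in
/-- **The normality step.** Let `S` be a ring, `P` a prime ideal with `S/P` a regular local ring (only «`S/P` is a
NORMAL domain» is used, Matsumura 19.4), `f ∈ S` and `γ ∈ S_P` with `f − γ^p ∈ 𝔪_{S_P}` (`p ≥ 1`). Then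
`γ ≡ g₀ (mod 𝔪_{S_P})` for some `g₀ ∈ S`: writing `γ = a/s`, `ā^p = f̄ s̄^p` in `S/P`, so `s̄^p ∣ ā^p`, so `s̄ ∣ ā`
by normality (`IsIntegrallyClosed.pow_dvd_pow_iff`). [cite: Matsumura1987, Thm. 19.4] -/
theorem exists_sub_algebraMap_mem_maximalIdeal {S : Type u} [CommRing S] (P : Ideal S) [P.IsPrime]
    [IsRegularLocalRing (S ⧸ P)] (f : S) (γ : Localization.AtPrime P)
    (hγ : algebraMap S (Localization.AtPrime P) f - γ ^ p ∈ maximalIdeal (Localization.AtPrime P)) :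
    ∃ g₀ : S, γ - algebraMap S (Localization.AtPrime P) g₀ ∈ maximalIdeal (Localization.AtPrime P) := by
  have hp0 : p ≠ 0 := (Fact.out : p.Prime).ne_zero
  obtain ⟨a, s, hγe⟩ := IsLocalization.exists_mk'_eq P.primeCompl γ
  rw [← hγe] at hγ ⊢
  have hunit : IsUnit (algebraMap S (Localization.AtPrime P) (s : S)) :=
    IsLocalization.map_units (Localization.AtPrime P) s
  -- clear denominators: `s^p f − a^p ∈ P`
  have h1 : (s : S) ^ p * f - a ^ p ∈ P := by
    have key : algebraMap S (Localization.AtPrime P) ((s : S) ^ p * f - a ^ p) =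
        algebraMap S (Localization.AtPrime P) (s : S) ^ p *
          (algebraMap S (Localization.AtPrime P) f -
            IsLocalization.mk' (Localization.AtPrime P) a s ^ p) := by
      rw [map_sub, map_mul, map_pow, map_pow, mul_sub, ← mul_pow, IsLocalization.mk'_spec']
    rw [← IsLocalization.AtPrime.to_map_mem_maximal_iff (Localization.AtPrime P) P, key]
    exact Ideal.mul_mem_left _ _ hγ
  -- in the normal domain `S/P`: `s̄^p ∣ ā^p`, hence `s̄ ∣ ā`
  haveI : IsIntegrallyClosed (S ⧸ P) := isIntegrallyClosed_of_isRegularLocalRing (S ⧸ P)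
  have hdvd : Ideal.Quotient.mk P (s : S) ^ p ∣ Ideal.Quotient.mk P a ^ p := by
    refine ⟨Ideal.Quotient.mk P f, ?_⟩
    rw [← map_pow, ← map_pow, ← map_mul]
    exact (Ideal.Quotient.eq.mpr h1).symm
  obtain ⟨q, hq⟩ := (IsIntegrallyClosed.pow_dvd_pow_iff hp0).mp hdvd
  obtain ⟨g₀, rfl⟩ := Ideal.Quotient.mk_surjective q
  refine ⟨g₀, ?_⟩
  -- `a − s g₀ ∈ P`, so `s · (a/s − g₀) = a − s g₀ ∈ 𝔪_{S_P}`, and `s` is a unit there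
  have h2 : a - (s : S) * g₀ ∈ P := by
    rw [← Ideal.Quotient.eq, map_mul]
    exact hq
  have key : algebraMap S (Localization.AtPrime P) (s : S) *
      (IsLocalization.mk' (Localization.AtPrime P) a s - algebraMap S (Localization.AtPrime P) g₀) =
      algebraMap S (Localization.AtPrime P) (a - (s : S) * g₀) := by
    rw [mul_sub, IsLocalization.mk'_spec', map_sub, map_mul]
  rw [← Ideal.unit_mul_mem_iff_mem _ hunit, key]
  exact (IsLocalization.AtPrime.to_map_mem_maximal_iff (Localization.AtPrime P) P _).mpr h2

/-- **`⇒` (any prime `p`): singular at `P` forces a cleaning into `P²`.** For a regular local ring `S` of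
characteristic `p`, `f ∈ S` and a prime `P` with `S/P` regular: if the torsor germ `S_P[T]/(T^p − f)` is NOT regular,
then `f − g^p ∈ P²` for some `g ∈ S` (not merely some `g ∈ S_P`). Route: criterion at `P` (res-type-082 p503226) →
normality of `S/P` (`exists_sub_algebraMap_mem_maximalIdeal`) → `f − g₀^p = (f − γ^p) + (γ − g₀)^p ∈ 𝔪_{S_P}²`
(characteristic `p`) → `P² S_P ∩ S = P²` (`comap_map_pow_eq_pow_of_isRegularLocalRing_quotient`).
[cite: Matsumura1987, Thm. 14.2, Thm. 16.2, Thm. 19.4] -/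
theorem exists_sub_pow_mem_sq_of_not_isRegularLocalRing_atPrime (f : S) (P : Ideal S) [P.IsPrime]
    [IsRegularLocalRing (S ⧸ P)]
    (hsing : ¬ IsRegularLocalRing (AdjoinRoot
        (X ^ p - C (algebraMap S (Localization.AtPrime P) f) : (Localization.AtPrime P)[X]))) :
    ∃ g : S, f - g ^ p ∈ P ^ 2 := by
  have hp2 := (Fact.out : p.Prime).two_le
  set L := Localization.AtPrime P
  haveI : IsRegularLocalRing L := isRegularLocalRing_localization_atPrime S P
  haveI : CharP L p := charP_localization_atPrime (S := S) p P
  obtain ⟨γ, hγ⟩ := (RadicandSingular.not_isRegularLocalRing_adjoinRoot_atPrime_iff p P f).mp hsing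
  obtain ⟨g₀, hg₀⟩ :=
    exists_sub_algebraMap_mem_maximalIdeal p P f γ (Ideal.pow_le_self two_ne_zero hγ)
  refine ⟨g₀, ?_⟩
  have hsplit : algebraMap S L f - algebraMap S L g₀ ^ p =
      (algebraMap S L f - γ ^ p) + (γ - algebraMap S L g₀) ^ p := by
    rw [sub_pow_char]; ring
  have hmem : algebraMap S L (f - g₀ ^ p) ∈ maximalIdeal L ^ 2 := by
    rw [map_sub, map_pow, hsplit]
    exact Ideal.add_mem _ hγ (Ideal.pow_le_pow_right hp2 (Ideal.pow_mem_pow hg₀ p))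
  rw [← IsLocalization.AtPrime.map_eq_maximalIdeal P L, ← Ideal.map_pow, ← Ideal.mem_comap,
    comap_map_pow_eq_pow_of_isRegularLocalRing_quotient P L 2] at hmem
  exact hmem

/-- **`⇐` (any prime `p`, no hypothesis on `S/P`): a cleaning into `P²` makes the torsor singular at `P`**:
`f − g^p ∈ P² ⇒ f − g^p ∈ (P S_P)² = 𝔪_{S_P}²`, and the criterion at `P`. [cite: Matsumura1987, Thm. 14.2] -/
theorem not_isRegularLocalRing_atPrime_of_sub_pow_mem_sq (f : S) (P : Ideal S) [P.IsPrime] {g : S}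
    (hg : f - g ^ p ∈ P ^ 2) :
    ¬ IsRegularLocalRing (AdjoinRoot
        (X ^ p - C (algebraMap S (Localization.AtPrime P) f) : (Localization.AtPrime P)[X])) := by
  set L := Localization.AtPrime P
  haveI : IsRegularLocalRing L := isRegularLocalRing_localization_atPrime S P
  haveI : CharP L p := charP_localization_atPrime (S := S) p P
  refine (RadicandSingular.not_isRegularLocalRing_adjoinRoot_atPrime_iff p P f).mpr ⟨algebraMap S L g, ?_⟩
  rw [← map_pow, ← map_sub, ← IsLocalization.AtPrime.map_eq_maximalIdeal P L, ← Ideal.map_pow]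
  exact Ideal.mem_map_of_mem _ hg

/-- **Singular at `P` ⟺ some cleaning lies in `P²`** (any prime `p`; `S` regular local of characteristic `p`, `S/P`
regular). [cite: Matsumura1987, Thm. 14.2, Thm. 16.2, Thm. 19.4] -/
theorem not_isRegularLocalRing_atPrime_iff_exists_sub_pow_mem_sq (f : S) (P : Ideal S) [P.IsPrime]
    [IsRegularLocalRing (S ⧸ P)] :
    ¬ IsRegularLocalRing (AdjoinRoot
        (X ^ p - C (algebraMap S (Localization.AtPrime P) f) : (Localization.AtPrime P)[X])) ↔
      ∃ g : S, f - g ^ p ∈ P ^ 2 :=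
  ⟨exists_sub_pow_mem_sq_of_not_isRegularLocalRing_atPrime p f P,
    fun ⟨_, hg⟩ => not_isRegularLocalRing_atPrime_of_sub_pow_mem_sq p f P hg⟩

end Regular

/-! ## §2 The ORDER's `K`-form at `p = 2` and the permissibility corollary (§σ2 bodies unfolded) -/

section Two

variable (K : Type u) [Field K] [CharP K 2]

/-- **AUTO-EQUIMULTIPLICITY AT `p = 2`** (ORDER β of res-L0-w41-plan-1, HOME/STATUS 2026-08-27T06:08:01Z, verbatim
form; `hsing` = `IsSingPrime R 2 f P` of `Steer_r21.lean` §σ2 UNFOLDED): for a field `K` of characteristic `2`, a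
regular local subring `R ⊆ K`, `f ∈ R` and a prime `P` with `R/P` regular, if the torsor `T² = f` is singular at
`P` then `f − g² ∈ P²` for some `g ∈ R`. [cite: Matsumura1987, Thm. 14.2, Thm. 16.2, Thm. 19.4] -/
theorem exists_sub_sq_mem_sq_of_singular_atPrime (R : Subring K) [IsRegularLocalRing R] (f : R)
    (P : Ideal R) [P.IsPrime] (hRP : IsRegularLocalRing (R ⧸ P))
    (hsing : ¬ IsRegularLocalRing
      (AdjoinRoot (X ^ 2 - C (algebraMap R (Localization.AtPrime P) f) : (Localization.AtPrime P)[X]))) :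
    ∃ g : R, f - g ^ 2 ∈ P ^ 2 :=
  haveI := hRP
  exists_sub_pow_mem_sq_of_not_isRegularLocalRing_atPrime (S := R) 2 f P hsing

omit [CharP K 2] in
/-- The converse at any prime `p` in the `K`-form (no hypothesis on `R/P`): `f − g^p ∈ P²` for some `g ∈ R` makes
`T^p = f` singular at `P`. [cite: Matsumura1987, Thm. 14.2] -/
theorem singular_atPrime_of_sub_pow_mem_sq (p : ℕ) [Fact p.Prime] [CharP K p] (R : Subring K)
    [IsRegularLocalRing R] (f : R) (P : Ideal R) [P.IsPrime] {g : R} (hg : f - g ^ p ∈ P ^ 2) :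
    ¬ IsRegularLocalRing
      (AdjoinRoot (X ^ p - C (algebraMap R (Localization.AtPrime P) f) : (Localization.AtPrime P)[X])) :=
  not_isRegularLocalRing_atPrime_of_sub_pow_mem_sq (S := R) p f P hg

/-- **Permissibility at `p = 2`, parametric form.** For any propositions `A` (think `P ≠ 𝔪_R`) and `Top` (think
`IsTopSingComponent R 2 f P`) such that `Top` yields primality of `P` and singularity of `T² = f` at `P`:
`A ∧ Top ∧ (R/P regular) ∧ (∃ g, f − g² ∈ P²) ⟺ A ∧ Top ∧ (R/P regular)`. OURS. [folklore] -/
theorem permissible_iff_of_singular (R : Subring K) [IsRegularLocalRing R] (f : R) (P : Ideal R)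
    {A Top : Prop}
    (hTop : Top → ∃ _ : P.IsPrime, ¬ IsRegularLocalRing
      (AdjoinRoot (X ^ 2 - C (algebraMap R (Localization.AtPrime P) f) : (Localization.AtPrime P)[X]))) :
    (A ∧ Top ∧ IsRegularLocalRing (R ⧸ P) ∧ ∃ g : R, f - g ^ 2 ∈ P ^ 2) ↔
      (A ∧ Top ∧ IsRegularLocalRing (R ⧸ P)) := by
  refine ⟨fun ⟨hA, hT, hreg, _⟩ => ⟨hA, hT, hreg⟩, fun ⟨hA, hT, hreg⟩ => ⟨hA, hT, hreg, ?_⟩⟩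
  obtain ⟨_, hsing⟩ := hTop hT
  exact exists_sub_sq_mem_sq_of_singular_atPrime K R f P hreg hsing

/-- **COROLLARY (the consumer's form): at `p = 2` the equimultiplicity clause of `IsPermissibleCentre` is redundant.**
With the bodies of `IsPermissibleCentre R 2 f P` / `IsTopSingComponent R 2 f P` / `IsSingPrime R 2 f Q` /
`RadicandRing` of res-L0-w41-lead-1's `Steer_r21.lean` accb5a324610e606 §σ2 UNFOLDED (`p := 2`):
`IsPermissibleCentre R 2 f P ↔ P ≠ maximalIdeal R ∧ IsTopSingComponent R 2 f P ∧ IsRegularLocalRing (R ⧸ P)` —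
a σ_top-permissible centre at `p = 2` is exactly a top singular component `≠ 𝔪` with regular quotient; the
point step is taken iff every top singular component `≠ 𝔪` is itself SINGULAR at the centre.
OURS. [cite: Matsumura1987, Thm. 14.2, Thm. 16.2, Thm. 19.4] -/
theorem isPermissibleCentre_two_iff (R : Subring K) [IsRegularLocalRing R] (f : R) (P : Ideal R) :
    (P ≠ maximalIdeal R ∧
      (∃ _ : P.IsPrime,
        ¬ IsRegularLocalRing
            (AdjoinRoot (Polynomial.X ^ 2 - Polynomial.C (algebraMap R (Localization.AtPrime P) f))) ∧
          (∀ (Q : Ideal R) [Q.IsPrime],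
            ¬ IsRegularLocalRing
                (AdjoinRoot (Polynomial.X ^ 2 - Polynomial.C (algebraMap R (Localization.AtPrime Q) f))) →
              Q ≤ P → Q = P) ∧
          (∀ (Q : Ideal R) [Q.IsPrime],
            ¬ IsRegularLocalRing
                (AdjoinRoot (Polynomial.X ^ 2 - Polynomial.C (algebraMap R (Localization.AtPrime Q) f))) →
              (∀ (Q' : Ideal R) [Q'.IsPrime],
                ¬ IsRegularLocalRing
                    (AdjoinRoot (Polynomial.X ^ 2 -
                      Polynomial.C (algebraMap R (Localization.AtPrime Q') f))) →
                  Q' ≤ Q → Q' = Q) →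
              ringKrullDim (R ⧸ Q) ≤ ringKrullDim (R ⧸ P))) ∧
      IsRegularLocalRing (R ⧸ P) ∧ ∃ g : R, f - g ^ 2 ∈ P ^ 2) ↔
    (P ≠ maximalIdeal R ∧
      (∃ _ : P.IsPrime,
        ¬ IsRegularLocalRing
            (AdjoinRoot (Polynomial.X ^ 2 - Polynomial.C (algebraMap R (Localization.AtPrime P) f))) ∧
          (∀ (Q : Ideal R) [Q.IsPrime],
            ¬ IsRegularLocalRing
                (AdjoinRoot (Polynomial.X ^ 2 - Polynomial.C (algebraMap R (Localization.AtPrime Q) f))) →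
              Q ≤ P → Q = P) ∧
          (∀ (Q : Ideal R) [Q.IsPrime],
            ¬ IsRegularLocalRing
                (AdjoinRoot (Polynomial.X ^ 2 - Polynomial.C (algebraMap R (Localization.AtPrime Q) f))) →
              (∀ (Q' : Ideal R) [Q'.IsPrime],
                ¬ IsRegularLocalRing
                    (AdjoinRoot (Polynomial.X ^ 2 -
                      Polynomial.C (algebraMap R (Localization.AtPrime Q') f))) →
                  Q' ≤ Q → Q' = Q) →
              ringKrullDim (R ⧸ Q) ≤ ringKrullDim (R ⧸ P))) ∧
      IsRegularLocalRing (R ⧸ P)) :=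
  permissible_iff_of_singular K R f P fun ⟨hP, hsing, _, _⟩ => ⟨hP, hsing⟩

omit [CharP K 2] in
/-- **No permissible centre ⟺ every top singular component `≠ 𝔪` has singular quotient** (parametric form of the
point-step reading at `p = 2`: `Perm Q` / `Top Q` stand for the §σ2 bodies of `IsPermissibleCentre R 2 f Q` /
`IsTopSingComponent R 2 f Q`; the hypothesis `hPerm` is `isPermissibleCentre_two_iff` at each `Q`).
OURS. [folklore] -/
theorem not_exists_permissible_two_iff (R : Subring K) [IsLocalRing R] {Perm Top : Ideal R → Prop}
    (hPerm : ∀ Q, Perm Q ↔ (Q ≠ maximalIdeal R ∧ Top Q ∧ IsRegularLocalRing (R ⧸ Q))) :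
    (∀ Q : Ideal R, ¬ Perm Q) ↔
      ∀ Q : Ideal R, Q ≠ maximalIdeal R → Top Q → ¬ IsRegularLocalRing (R ⧸ Q) := by
  refine ⟨fun h Q hQ hT hreg => h Q ((hPerm Q).mpr ⟨hQ, hT, hreg⟩), fun h Q hPQ => ?_⟩
  obtain ⟨hQ, hT, hreg⟩ := (hPerm Q).mp hPQ
  exact h Q hQ hT hreg

omit [CharP K 2] in
/-- **The POINT STEP at `p = 2`** (parametric: `Perm` / `Top` stand for the §σ2 bodies of `IsPermissibleCentre R 2 f ·` /
`IsTopSingComponent R 2 f ·` and `hPerm` is `isPermissibleCentre_two_iff` at each `Q`; `E` is the point-step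
multiplicity clause `∃ g, f − g² ∈ 𝔪²`; the left-hand side is the body of `IsSigmaTopCentre R 2 f (maximalIdeal R)`):
σ_top takes the point step iff EVERY top singular component `≠ 𝔪` has SINGULAR quotient `R/Q` (and `E`).
OURS. [folklore] -/
theorem sigmaTopCentre_maximalIdeal_two_iff (R : Subring K) [IsLocalRing R] {Perm Top : Ideal R → Prop}
    {E : Prop} (hPerm : ∀ Q, Perm Q ↔ (Q ≠ maximalIdeal R ∧ Top Q ∧ IsRegularLocalRing (R ⧸ Q))) :
    (Perm (maximalIdeal R) ∨ (maximalIdeal R = maximalIdeal R ∧ (∀ Q : Ideal R, ¬ Perm Q) ∧ E)) ↔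
      ((∀ Q : Ideal R, Q ≠ maximalIdeal R → Top Q → ¬ IsRegularLocalRing (R ⧸ Q)) ∧ E) := by
  rw [← not_exists_permissible_two_iff K R hPerm]
  constructor
  · rintro (h | ⟨-, h, hE⟩)
    · exact absurd rfl ((hPerm _).mp h).1
    · exact ⟨h, hE⟩
  · rintro ⟨h, hE⟩
    exact Or.inr ⟨rfl, h, hE⟩

end Two

end Summit.ResolutionOfSingularities.ResolutionOfSingularities.Theorems.SwitchingDichotomy.AutoPermissible

end
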